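import Mathlib
import Summits.ValiantsHypothesis.ValiantsHypothesis.Theses.ProjectionRigidity
import Literature.Computability.AlgebraicComplexity.GrenetProjection
import Literature.Computability.AlgebraicComplexity.DetReprEquivalent
import Literature.Computability.AlgebraicComplexity.StandardFamiliesProofs
import Literature.Computability.AlgebraicComplexity.RankOneDeterminantalExpressionsProofs

/-!
# `stub_windowReduction` of line `birth` is FALSE — an `8 × 8` non-window projection of `per₃`

Crux `ProjectionRigidity.ProjLaplaceDoubling` (stmt-ValiantsHypothesis-16002), registered line
`Cruxes/ProjLaplaceDoubling/Lines/birth.lean` (skeleton sha `031e04b2…`), stub 1 (`stub_windowReduction`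
= the route's foreseen child **ProjWindowReduction**), verbatim:

> for `n ≥ 3` with `2ⁿ − 1 ≤ N := pdc(per_n)`, every `m × m` projection matrix `B` (`m ≤ 2N`) with
> `det B = per_n` is constant-gauge equivalent (`B' = P·B·Q`, `P, Q ∈ GL_m(ℂ)`) to a block upper
> triangular matrix for a partition `(a | N | m − a − N)` whose middle block is a PROJECTION matrix of
> determinant exactly `per_n`.

**Refutation at the smallest conceivable size `(n, m) = (3, 8)`** (`N = 7` by
`detProjectionComplexity_perPoly_three`; `8 ≤ 14`).  Witness: the "row-Laplace" branching program of
`per₃ = ∑_σ ∏_c X(σ c, c)` — expand along matrix row `2`, then compute the three complementary `2 × 2`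
permanents with a SHARED second layer (vertices `s | 1 2 3 | 4 5 6 7`; `s →(X(2,c)) c+1`;
`1 → 6, 7` by `X(0,1), X(1,1)`; `2 → 4, 5` by `X(0,2), X(1,2)`; `3 → 4, 5` by `X(0,1), X(1,1)`; returns
`4, 5, 6, 7 → s` by `X(1,0), X(0,0), X(1,2), X(0,2)`):
```
B8 = !![0, X20, X21, X22, 0,   0,   0,   0;
        0, 1,   0,   0,   0,   0,   X01, X11;
        0, 0,   1,   0,   X02, X12, 0,   0;
        0, 0,   0,   1,   X01, X11, 0,   0;
        X10, 0, 0,   0,   1,   0,   0,   0;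
        X00, 0, 0,   0,   0,   1,   0,   0;
        X12, 0, 0,   0,   0,   0,   1,   0;
        X02, 0, 0,   0,   0,   0,   0,   1]
```
Every cell is `0`, `1` or a variable and `det B8 = per₃` (unipotent factorisation `B8·E₁·E₂ = T`, `T` upper
triangular with diagonal `(per₃, 1, …, 1)`).  The point: EVERY row and EVERY column of `B8` contains a
variable cell whose variable occurs nowhere else in that cell's column, resp. row ("pins"), so the linear
part of `B8` has `ℂ`-linearly independent rows and `ℂ`-linearly independent columns.

Why no window exists.  At `m = 8 = N + 1` a window is `(0 | 7 | 1)` or `(1 | 7 | 0)`.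
* `(0 | 7 | 1)`: the last row of `B' = P·B8·Q` is `(0, …, 0, d)`; Laplace along it and `det(core) = per₃`
  give `d · per₃ = det B' = C(det P · det Q) · per₃`, so `d` is the CONSTANT `det P · det Q` (`per₃ ≠ 0`,
  `ℂ[x]` a domain).  Hence `r·B8·Q`, `r` = last row of `P`, has no linear part; `Q` being invertible,
  `r · L_v = 0` for every coefficient matrix `L_v` of `B8`, and the row pins force `r = 0` — a zero row in
  the invertible `P`.
* `(1 | 7 | 0)`: symmetrically the first column of `B'` is `(d, 0, …, 0)ᵀ` with `d` constant, so
  `L_v · s = 0` for the first column `s` of `Q`, and the column pins force `s = 0`.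

So the window normal form fails already one step above the optimal size, for a cancellation-free,
`{0,1}`-valued, multilinear branching program (not only for the purified Koszul twists of sizes 10–14 of
`Lines/birth-dead.md`, whose non-window proofs need the module-theoretic lattice argument): reading the
columns of the variable matrix in a path-dependent order is enough.  Consequently NO statement of the form
"projections of `per_n` of size `≤ N + 1` are constant-gauge block-triangular over an `N`-core" can serve
as the reduction step of the doubling argument.

The theorem below is LITERALLY `¬` the registered stub (ll. 246–265 of `Lines/birth.lean`, vocabulary
inlined, same `open`s).  Unconditional; axioms `propext`, `Classical.choice`, `Quot.sound`.
Exact external re-check (Leibniz expansion over `8!` permutations, kernel ranks `8/8`):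
refuter folder `compute/verify8.py`.  Refuter cdisprove seat, 2026-08-17.
-/

-- single-conjunct layout: Sub = Summit, duplicated namespace component intended
set_option linter.dupNamespace false

namespace Summit.ValiantsHypothesis.ValiantsHypothesis.Theorems.ProjLaplaceDoubling.Negative

open MvPolynomial Matrix
open Literature.Computability.AlgebraicComplexity
open Summit.ValiantsHypothesis.ValiantsHypothesis.Theses.ProjectionRigidity

set_option maxHeartbeats 1600000 in
/-- **`stub_windowReduction` (line `birth` of crux `ProjLaplaceDoubling`) is false**: at `n = 3`, `m = 8`
the row-Laplace branching program `B8` of `per₃` (an `8 × 8` `{0,1,X}`-projection of `DET₈`) admits no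
constant-gauge window `(a | 7 | 1 - a)` with a projection core of determinant `per₃`, because its linear
part has linearly independent rows and columns (pins) while a window forces a zero row of `P`
(`a = 0`) or a zero column of `Q` (`a = 1`). [folklore] -/
theorem stub_windowReduction_false : ¬ (
    ∀ n : ℕ, 3 ≤ n → 2 ^ n - 1 ≤ detProjectionComplexity (perPoly (Fin n) ℂ) →
    ∀ m : ℕ, m ≤ 2 * detProjectionComplexity (perPoly (Fin n) ℂ) →
      ∀ B : Matrix (Fin m) (Fin m) (MvPolynomial (Fin n × Fin n) ℂ),
        (∀ p q, (∃ v, B p q = MvPolynomial.X v) ∨ ∃ c, B p q = MvPolynomial.C c) →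
        B.det = perPoly (Fin n) ℂ →
        ∃ (a : ℕ) (h : a + detProjectionComplexity (perPoly (Fin n) ℂ) ≤ m) (P Q : GL (Fin m) ℂ)
          (B' : Matrix (Fin m) (Fin m) (MvPolynomial (Fin n × Fin n) ℂ)),
          B' = (P : Matrix (Fin m) (Fin m) ℂ).map MvPolynomial.C * B *
                (Q : Matrix (Fin m) (Fin m) ℂ).map MvPolynomial.C ∧
          (∀ p q : Fin m, a ≤ (p : ℕ) → (q : ℕ) < a → B' p q = 0) ∧
          (∀ p q : Fin m, a + detProjectionComplexity (perPoly (Fin n) ℂ) ≤ (p : ℕ) →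
            (q : ℕ) < a + detProjectionComplexity (perPoly (Fin n) ℂ) → B' p q = 0) ∧
          (∀ p q : Fin (detProjectionComplexity (perPoly (Fin n) ℂ)),
            (∃ v, B' (Fin.castLE h (Fin.natAdd a p)) (Fin.castLE h (Fin.natAdd a q)) = MvPolynomial.X v) ∨
              ∃ c, B' (Fin.castLE h (Fin.natAdd a p)) (Fin.castLE h (Fin.natAdd a q)) = MvPolynomial.C c) ∧
          (B'.submatrix
              (fun p : Fin (detProjectionComplexity (perPoly (Fin n) ℂ)) => Fin.castLE h (Fin.natAdd a p))
              (fun q : Fin (detProjectionComplexity (perPoly (Fin n) ℂ)) => Fin.castLE h (Fin.natAdd a q))).det =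
            perPoly (Fin n) ℂ) := by
  intro hW
  have pdc3 : detProjectionComplexity (perPoly (Fin 3) ℂ) = 7 := detProjectionComplexity_perPoly_three
  -- ### the witness and its unipotent factorisation `B8 * E1 = A1`, `A1 * E2 = T`
  obtain ⟨B, hB⟩ : ∃ M : Matrix (Fin 8) (Fin 8) (MvPolynomial (Fin 3 × Fin 3) ℂ), M =
      !![0, X (2,0), X (2,1), X (2,2), 0, 0, 0, 0;
         0, 1, 0, 0, 0, 0, X (0,1), X (1,1);
         0, 0, 1, 0, X (0,2), X (1,2), 0, 0;
         0, 0, 0, 1, X (0,1), X (1,1), 0, 0;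
         X (1,0), 0, 0, 0, 1, 0, 0, 0;
         X (0,0), 0, 0, 0, 0, 1, 0, 0;
         X (1,2), 0, 0, 0, 0, 0, 1, 0;
         X (0,2), 0, 0, 0, 0, 0, 0, 1] := ⟨_, rfl⟩
  obtain ⟨E1, hE1⟩ : ∃ M : Matrix (Fin 8) (Fin 8) (MvPolynomial (Fin 3 × Fin 3) ℂ), M =
      !![1, 0, 0, 0, 0, 0, 0, 0;
         0, 1, 0, 0, 0, 0, -X (0,1), -X (1,1);
         0, 0, 1, 0, -X (0,2), -X (1,2), 0, 0;
         0, 0, 0, 1, -X (0,1), -X (1,1), 0, 0;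
         0, 0, 0, 0, 1, 0, 0, 0;
         0, 0, 0, 0, 0, 1, 0, 0;
         0, 0, 0, 0, 0, 0, 1, 0;
         0, 0, 0, 0, 0, 0, 0, 1] := ⟨_, rfl⟩
  obtain ⟨E2, hE2⟩ : ∃ M : Matrix (Fin 8) (Fin 8) (MvPolynomial (Fin 3 × Fin 3) ℂ), M =
      !![1, 0, 0, 0, 0, 0, 0, 0;
         0, 1, 0, 0, 0, 0, 0, 0;
         0, 0, 1, 0, 0, 0, 0, 0;
         0, 0, 0, 1, 0, 0, 0, 0;
         -X (1,0), 0, 0, 0, 1, 0, 0, 0;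
         -X (0,0), 0, 0, 0, 0, 1, 0, 0;
         -X (1,2), 0, 0, 0, 0, 0, 1, 0;
         -X (0,2), 0, 0, 0, 0, 0, 0, 1] := ⟨_, rfl⟩
  obtain ⟨A1, hA1⟩ : ∃ M : Matrix (Fin 8) (Fin 8) (MvPolynomial (Fin 3 × Fin 3) ℂ), M =
      !![0, X (2,0), X (2,1), X (2,2), -(X (2,1) * X (0,2) + X (2,2) * X (0,1)),
           -(X (2,1) * X (1,2) + X (2,2) * X (1,1)), -(X (2,0) * X (0,1)), -(X (2,0) * X (1,1));
         0, 1, 0, 0, 0, 0, 0, 0;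
         0, 0, 1, 0, 0, 0, 0, 0;
         0, 0, 0, 1, 0, 0, 0, 0;
         X (1,0), 0, 0, 0, 1, 0, 0, 0;
         X (0,0), 0, 0, 0, 0, 1, 0, 0;
         X (1,2), 0, 0, 0, 0, 0, 1, 0;
         X (0,2), 0, 0, 0, 0, 0, 0, 1] := ⟨_, rfl⟩
  obtain ⟨T, hT⟩ : ∃ M : Matrix (Fin 8) (Fin 8) (MvPolynomial (Fin 3 × Fin 3) ℂ), M =
      !![perPoly (Fin 3) ℂ, X (2,0), X (2,1), X (2,2), -(X (2,1) * X (0,2) + X (2,2) * X (0,1)),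
           -(X (2,1) * X (1,2) + X (2,2) * X (1,1)), -(X (2,0) * X (0,1)), -(X (2,0) * X (1,1));
         0, 1, 0, 0, 0, 0, 0, 0;
         0, 0, 1, 0, 0, 0, 0, 0;
         0, 0, 0, 1, 0, 0, 0, 0;
         0, 0, 0, 0, 1, 0, 0, 0;
         0, 0, 0, 0, 0, 1, 0, 0;
         0, 0, 0, 0, 0, 0, 1, 0;
         0, 0, 0, 0, 0, 0, 0, 1] := ⟨_, rfl⟩
  have p3 : perPoly (Fin 3) ℂ = X (0,0) * (X (1,1) * X (2,2) + X (2,1) * X (1,2))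
      + X (1,0) * (X (0,1) * X (2,2) + X (2,1) * X (0,2))
      + X (2,0) * (X (0,1) * X (1,2) + X (1,1) * X (0,2)) := by
    simp [perPoly, permanent_fin_three, Matrix.mvPolynomialX_apply]
  have coeff_one_single : ∀ v : Fin 3 × Fin 3,
      (1 : MvPolynomial (Fin 3 × Fin 3) ℂ).coeff (Finsupp.single v 1) = 0 := fun v => by
    rw [MvPolynomial.coeff_one, if_neg]
    exact Ne.symm (Finsupp.single_ne_zero.mpr one_ne_zero)
  -- ### ONE inspection of the 64 cells: the two products, triangularity, and the shape of the cells
  have big : ∀ i j : Fin 8,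
      ((B * E1) i j = A1 i j ∧ (A1 * E2) i j = T i j) ∧
      ((j < i → E1 i j = 0) ∧ (j < i → T i j = 0) ∧ (i < j → E2 i j = 0)) ∧
      (B i j = 0 ∨ B i j = 1 ∨ ∃ w, B i j = X w) := by
    intro i j
    rw [hB, hE1, hE2, hA1, hT, p3]
    fin_cases i <;> fin_cases j <;> refine ⟨⟨?_, ?_⟩, ⟨?_, ?_, ?_⟩, ?_⟩ <;>
      simp [Matrix.mul_apply, Fin.sum_univ_eight]
    all_goals ring
  -- ### `B8` is a projection matrix with `det B8 = per₃`
  have hproj : ∀ p q : Fin 8, (∃ v, B p q = MvPolynomial.X v) ∨ ∃ c, B p q = MvPolynomial.C c := by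
    intro p q
    rcases (big p q).2.2 with h | h | ⟨w, h⟩
    · exact Or.inr ⟨0, by rw [h, map_zero]⟩
    · exact Or.inr ⟨1, by rw [h, map_one]⟩
    · exact Or.inl ⟨w, h⟩
  have hdet : B.det = perPoly (Fin 3) ℂ := by
    have h1 : B * E1 = A1 := Matrix.ext fun i j => (big i j).1.1
    have h2 : A1 * E2 = T := Matrix.ext fun i j => (big i j).1.2
    have dE1 : E1.det = 1 := by
      rw [Matrix.det_of_upperTriangular (M := E1) fun i j hij => (big i j).2.1.1 hij,
        Fin.prod_univ_eight, hE1]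
      simp
    have dE2 : E2.det = 1 := by
      rw [Matrix.det_of_lowerTriangular E2 (fun i j hij => (big i j).2.1.2.2 hij),
        Fin.prod_univ_eight, hE2]
      simp
    have dT : T.det = perPoly (Fin 3) ℂ := by
      rw [Matrix.det_of_upperTriangular (M := T) fun i j hij => (big i j).2.1.2.1 hij,
        Fin.prod_univ_eight, hT]
      simp
    have h := congrArg Matrix.det h2
    rwa [← h1, Matrix.det_mul, Matrix.det_mul, dE1, dE2, dT, mul_one, mul_one] at h
  -- ### pins: a variable cell in every row (resp. column) whose variable is alone in its column (resp. row)
  have rowPin : ∀ i i' : Fin 8,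
      (B i' (![1, 6, 4, 5, 0, 0, 0, 0] i)).coeff
        (Finsupp.single (![((2 : Fin 3), (0 : Fin 3)), (0,1), (0,2), (1,1), (1,0), (0,0), (1,2), (0,2)] i) 1) =
      if i' = i then 1 else 0 := by
    intro i i'
    rw [hB]
    fin_cases i <;> fin_cases i' <;>
      simp [MvPolynomial.coeff_X, Finsupp.single_left_inj, coeff_one_single]
  have colPin : ∀ j j' : Fin 8,
      (B (![4, 0, 0, 0, 2, 2, 1, 1] j) j').coeff
        (Finsupp.single (![((1 : Fin 3), (0 : Fin 3)), (2,0), (2,1), (2,2), (0,2), (1,2), (0,1), (1,1)] j) 1) =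
      if j' = j then 1 else 0 := by
    intro j j'
    rw [hB]
    fin_cases j <;> fin_cases j' <;>
      simp [MvPolynomial.coeff_X, Finsupp.single_left_inj, coeff_one_single]
  -- ### apply the stub at `(n, m, B) = (3, 8, B8)`
  obtain ⟨a, ha, P, Q, B', hB', hz1, hz2, -, hcore⟩ :=
    hW 3 le_rfl (by rw [pdc3]; norm_num) 8 (by rw [pdc3]; norm_num) B hproj hdet
  have ha1 : a ≤ 1 := by have h := ha; rw [pdc3] at h; omega
  have hdetB' : B'.det = C ((P : Matrix (Fin 8) (Fin 8) ℂ).det * (Q : Matrix (Fin 8) (Fin 8) ℂ).det) *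
      perPoly (Fin 3) ℂ := by
    rw [hB', det_map_C_mul_mul_map_C, hdet]
  have hPunit : IsUnit (P : Matrix (Fin 8) (Fin 8) ℂ).det :=
    (Matrix.isUnit_iff_isUnit_det _).mp (Units.isUnit P)
  have hQunit : IsUnit (Q : Matrix (Fin 8) (Fin 8) ℂ).det :=
    (Matrix.isUnit_iff_isUnit_det _).mp (Units.isUnit Q)
  -- linear coefficients of the cells of `B' = P·B·Q`
  have lin_entry : ∀ (v : Fin 3 × Fin 3) (p q : Fin 8), (B' p q).coeff (Finsupp.single v 1) =
      ∑ k, (∑ i, (P : Matrix (Fin 8) (Fin 8) ℂ) p i * (B i k).coeff (Finsupp.single v 1)) *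
        (Q : Matrix (Fin 8) (Fin 8) ℂ) k q := by
    intro v p q
    have hc : ∀ (f : MvPolynomial (Fin 3 × Fin 3) ℂ) (c : ℂ),
        (f * C c).coeff (Finsupp.single v 1) = f.coeff (Finsupp.single v 1) * c := fun f c => by
      rw [mul_comm, MvPolynomial.coeff_C_mul, mul_comm]
    rw [hB']
    simp only [Matrix.mul_apply, Matrix.map_apply, MvPolynomial.coeff_sum, hc, MvPolynomial.coeff_C_mul]
  have lin_entry' : ∀ (v : Fin 3 × Fin 3) (p q : Fin 8), (B' p q).coeff (Finsupp.single v 1) =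
      ∑ i, (P : Matrix (Fin 8) (Fin 8) ℂ) p i *
        ∑ k, (B i k).coeff (Finsupp.single v 1) * (Q : Matrix (Fin 8) (Fin 8) ℂ) k q := by
    intro v p q
    rw [lin_entry]
    simp only [Finset.sum_mul, Finset.mul_sum, mul_assoc]
    rw [Finset.sum_comm]
  have coeff_C_single : ∀ (v : Fin 3 × Fin 3) (c : ℂ),
      (C c : MvPolynomial (Fin 3 × Fin 3) ℂ).coeff (Finsupp.single v 1) = 0 := fun v c => by
    rw [MvPolynomial.coeff_C, if_neg]
    exact Ne.symm (Finsupp.single_ne_zero.mpr one_ne_zero)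
  obtain rfl | rfl : a = 0 ∨ a = 1 := by omega
  · -- ### window `(0 | 7 | 1)`: the last row of `B'` is `(0, …, 0, d)`
    have hz : ∀ q : Fin 8, (q : ℕ) < 7 → B' (Fin.last 7) q = 0 := fun q hq =>
      hz2 (Fin.last 7) q (by rw [pdc3]; simp) (by rw [pdc3]; simpa using hq)
    have hcore' : (B'.submatrix Fin.castSucc Fin.castSucc).det = perPoly (Fin 3) ℂ := by
      rw [← Matrix.det_submatrix_equiv_self (finCongr pdc3), Matrix.submatrix_submatrix]
      convert hcore using 4 <;> (apply Fin.ext; simp)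
    have hlap : B'.det = B' (Fin.last 7) (Fin.last 7) * perPoly (Fin 3) ℂ := by
      rw [Matrix.det_succ_row B' (Fin.last 7), Fin.sum_univ_castSucc,
        Finset.sum_eq_zero (fun j _ => by
          rw [hz (Fin.castSucc j) (by rw [Fin.val_castSucc]; exact j.2), mul_zero, zero_mul]),
        zero_add, Fin.succAbove_last, hcore']
      simp
      norm_num
    have hcorner : B' (Fin.last 7) (Fin.last 7) =
        C ((P : Matrix (Fin 8) (Fin 8) ℂ).det * (Q : Matrix (Fin 8) (Fin 8) ℂ).det) :=
      mul_right_cancel₀ (perPoly_ne_zero (Fin 3) ℂ) (hlap.symm.trans hdetB')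
    -- the linear parts of `r · B8`, `r` the last row of `P`, vanish
    have hω : ∀ v : Fin 3 × Fin 3,
        (fun k => ∑ i, (P : Matrix (Fin 8) (Fin 8) ℂ) (Fin.last 7) i * (B i k).coeff (Finsupp.single v 1)) = 0 := by
      intro v
      set ω : Fin 8 → ℂ :=
        fun k => ∑ i, (P : Matrix (Fin 8) (Fin 8) ℂ) (Fin.last 7) i * (B i k).coeff (Finsupp.single v 1)
        with hω
      have h1 : ω ᵥ* (Q : Matrix (Fin 8) (Fin 8) ℂ) = 0 := by
        funext q
        change ∑ k, ω k * (Q : Matrix (Fin 8) (Fin 8) ℂ) k q = 0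
        rw [← lin_entry v (Fin.last 7) q]
        by_cases hq : (q : ℕ) < 7
        · rw [hz q hq, MvPolynomial.coeff_zero]
        · have hq' : q = Fin.last 7 := Fin.ext (by have := q.2; simp; omega)
          rw [hq', hcorner, coeff_C_single]
      have h2 : ω = ω ᵥ* (Q : Matrix (Fin 8) (Fin 8) ℂ) ᵥ* ((Q⁻¹ : GL (Fin 8) ℂ) : Matrix (Fin 8) (Fin 8) ℂ) := by
        rw [Matrix.vecMul_vecMul, Units.mul_inv, Matrix.vecMul_one]
      rw [h2, h1, Matrix.zero_vecMul]
    have hrow : ∀ i, (P : Matrix (Fin 8) (Fin 8) ℂ) (Fin.last 7) i = 0 := by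
      intro i
      have h := congrFun (hω (![((2 : Fin 3), (0 : Fin 3)), (0,1), (0,2), (1,1), (1,0), (0,0), (1,2), (0,2)] i))
        (![1, 6, 4, 5, 0, 0, 0, 0] i)
      simp only [rowPin i, mul_ite, mul_one, mul_zero, Finset.sum_ite_eq', Finset.mem_univ, if_true,
        Pi.zero_apply] at h
      exact h
    exact hPunit.ne_zero (Matrix.det_eq_zero_of_row_eq_zero (Fin.last 7) hrow)
  · -- ### window `(1 | 7 | 0)`: the first column of `B'` is `(d, 0, …, 0)ᵀ`
    have hz : ∀ p : Fin 8, 1 ≤ (p : ℕ) → B' p 0 = 0 := fun p hp => hz1 p 0 hp (by simp)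
    have hcore' : (B'.submatrix Fin.succ Fin.succ).det = perPoly (Fin 3) ℂ := by
      rw [← Matrix.det_submatrix_equiv_self (finCongr pdc3), Matrix.submatrix_submatrix]
      convert hcore using 4 <;> (apply Fin.ext; simp [add_comm])
    have hlap : B'.det = B' 0 0 * perPoly (Fin 3) ℂ := by
      rw [Matrix.det_succ_column_zero B', Fin.sum_univ_succ,
        Finset.sum_eq_zero (fun i _ => by
          rw [hz (Fin.succ i) (by rw [Fin.val_succ]; omega), mul_zero, zero_mul]),
        add_zero, Fin.succAbove_zero, hcore']
      simp
    have hcorner : B' 0 0 =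
        C ((P : Matrix (Fin 8) (Fin 8) ℂ).det * (Q : Matrix (Fin 8) (Fin 8) ℂ).det) :=
      mul_right_cancel₀ (perPoly_ne_zero (Fin 3) ℂ) (hlap.symm.trans hdetB')
    -- the linear parts of `B8 · s`, `s` the first column of `Q`, vanish
    have hω : ∀ v : Fin 3 × Fin 3,
        (fun i => ∑ k, (B i k).coeff (Finsupp.single v 1) * (Q : Matrix (Fin 8) (Fin 8) ℂ) k 0) = 0 := by
      intro v
      set ω : Fin 8 → ℂ :=
        fun i => ∑ k, (B i k).coeff (Finsupp.single v 1) * (Q : Matrix (Fin 8) (Fin 8) ℂ) k 0 with hω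
      have h1 : (P : Matrix (Fin 8) (Fin 8) ℂ) *ᵥ ω = 0 := by
        funext p
        change ∑ i, (P : Matrix (Fin 8) (Fin 8) ℂ) p i * ω i = 0
        rw [← lin_entry' v p 0]
        by_cases hp : 1 ≤ (p : ℕ)
        · rw [hz p hp, MvPolynomial.coeff_zero]
        · have hp' : p = 0 := Fin.ext (by simp at hp ⊢; omega)
          rw [hp', hcorner, coeff_C_single]
      have h2 : ω = ((P⁻¹ : GL (Fin 8) ℂ) : Matrix (Fin 8) (Fin 8) ℂ) *ᵥ ((P : Matrix (Fin 8) (Fin 8) ℂ) *ᵥ ω) := by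
        rw [Matrix.mulVec_mulVec, Units.inv_mul, Matrix.one_mulVec]
      rw [h2, h1, Matrix.mulVec_zero]
    have hcol : ∀ j, (Q : Matrix (Fin 8) (Fin 8) ℂ) j 0 = 0 := by
      intro j
      have h := congrFun (hω (![((1 : Fin 3), (0 : Fin 3)), (2,0), (2,1), (2,2), (0,2), (1,2), (0,1), (1,1)] j))
        (![4, 0, 0, 0, 2, 2, 1, 1] j)
      simp only [colPin j, ite_mul, one_mul, zero_mul, Finset.sum_ite_eq', Finset.mem_univ, if_true,
        Pi.zero_apply] at h
      exact h
    exact hQunit.ne_zero (Matrix.det_eq_zero_of_column_eq_zero 0 hcol)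

end Summit.ValiantsHypothesis.ValiantsHypothesis.Theorems.ProjLaplaceDoubling.Negative
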